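import Literature.IUT.HodgeArakelov.ModelCyclotomes

/-!
# Bridge B8 / [IUTchII] Cor. 1.10 junction: automorphisms of `Π^tp_X` act on the interior cyclotome of the
# [EtTh] model (`ρ_A` of `MonoThetaBaseDatum`, from [EtTh] Cor. 2.18 (i))

abc-iut cell (abc-iut-w5-d145; continuation of `ModelCyclotomes.lean`, bridge B8 part 5a, abc-iut-L6-d6, and of
the sub-DAG `plan/L6/SUBDAG-IUTchII-Cor-110.md`, row C110-S10a). S. Mochizuki, *Inter-universal Teichmüller theory
II*, §1 Def. 1.1 (i), kurims p. 21: "a subquotient `(l·Δ_Θ)(M)` of `Π_Y(M)` which admits a natural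
`Π_X(M)`-action" [claim: Mochizuki2012, status: disputed] (IUTchII §1 Def 1.1 (i), kurims p.21); S. Mochizuki,
*The étale theta function …* [EtTh], Cor. 2.18 (i) p. 60: "any isomorphism `Π• ⥲ Π^tp` maps the above
subquotients, respectively, to the subquotients … of `Π^tp`" [cite: MochizukiEtTh2009, Cor 2.18(i) p.60].

The functorial family of [IUTchII] Cor. 1.10 (`MonoThetaRigidityData`, `MonoThetaCor110SubdagStatements.lean`)
is obtained from a base datum with an `Aut(Π)`-ACTION (`MonoThetaBaseDatum`, `MonoThetaCor110FamilyOfBase.lean`),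
whose interior component `ρ_A(γ)` is the automorphism of `(l·Δ_Θ)` induced by an automorphism `γ` of the
topological group `Π^tp_X`. This file CONSTRUCTS that component for the [EtTh] model of L2's `RigidData`
(part 5a's `ModelCyclotomes.intCyc R` = `(l·Δ_Θ ∩ Π^tp_Y)/(thetaKer ∩ Π^tp_Y)` with its conjugation action
`intAct`), by pure group theory:

* `SubquotientKit.autQuot`: an automorphism `γ` of `P` preserving the normal subgroups `B ≤ A` induces an
  automorphism of `A/B` (`autQuot_mk`), functorial (`autQuot_refl`, `autQuot_trans`) and `γ`-SEMILINEAR for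
  the conjugation action (`autQuot_conjQuot`: `γ̄(x · q) = γ(x) · γ̄(q)`);
* `ModelCyclotomes.intCycAut γ hK hL`: the induced automorphism of the interior cyclotome for `γ` preserving
  `thetaKer` and `lDeltaTheta` — two of the clauses of [EtTh] Cor. 2.18 (i) (L2 `RigidData.Cor218_i`) — with
  `intCycAut_intAct` (semilinearity), `intCycAut_refl`, `intCycAut_trans`; `intCycAut_of_cor218_i` packages
  the hypotheses from the named fact;
* `ModelCyclotomes.intModEquiv_intCycAut`: through the mod-`N` rigidity identification `intModEquiv R`
  (induced by `thetaMod`), `intCycAut γ` acts on `(l·Δ_Θ) ⊗ ℤ/N ≅ μ_N` by the coefficient automorphism `γ̄_μ`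
  of L2's `RigidData.exists_mulEquiv_thetaMod_comp` (`thetaMod (γ g) = γ̄_μ (thetaMod g)`) — PROVED in the
  form: for every `γ̄_μ` with that property.

HONEST FRAMING: group-theoretic bookkeeping over a refereed source's typed interface; no new named fact;
nothing disputed is asserted; no side is taken on [IUTchIII] Cor. 3.12; typed ≠ discharged.
-/

noncomputable section

namespace Literature.IUT.HodgeArakelov

universe u

open Literature.AnabelianGeometry.EtaleTheta

/-! ## Generic: an automorphism preserving `B ≤ A` acts on `A/B`, semilinearly for conjugation -/

namespace SubquotientKit

variable {P : Type u} [Group P] {A B : Subgroup P}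

/-- The restriction of an automorphism `γ` of `P` to a subgroup `A` it preserves (`A.map γ = A`).
[claim: Mochizuki2012, status: disputed] (IUTchII §1 Def 1.1 (i), kurims p.21) -/
def restrictEquiv (γ : P ≃* P) (hA : A.map γ.toMonoidHom = A) : ↥A ≃* ↥A :=
  (γ.subgroupMap A).trans (MulEquiv.subgroupCongr hA)

/-- `restrictEquiv` on underlying elements is `γ`. [claim: Mochizuki2012, status: disputed] (IUTchII §1 Def 1.1 (i), kurims p.21) -/
@[simp] theorem coe_restrictEquiv (γ : P ≃* P) (hA : A.map γ.toMonoidHom = A) (a : ↥A) :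
    ((restrictEquiv γ hA a : ↥A) : P) = γ a := rfl

/-- `restrictEquiv γ` maps `B ∩ A` onto itself when `γ` preserves `B` as well.
[claim: Mochizuki2012, status: disputed] (IUTchII §1 Def 1.1 (i), kurims p.21) -/
theorem map_restrictEquiv_subgroupOf (γ : P ≃* P) (hA : A.map γ.toMonoidHom = A)
    (hB : B.map γ.toMonoidHom = B) :
    (B.subgroupOf A).map ((restrictEquiv γ hA : ↥A ≃* ↥A) : ↥A →* ↥A) = B.subgroupOf A := by
  ext a
  constructor
  · rintro ⟨b, hb, rfl⟩
    change ((restrictEquiv γ hA b : ↥A) : P) ∈ B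
    rw [coe_restrictEquiv, ← hB]
    exact ⟨b, hb, rfl⟩
  · intro ha
    have ha' : ((a : ↥A) : P) ∈ B.map γ.toMonoidHom := by rw [hB]; exact ha
    obtain ⟨b₀, hb₀, hb₀eq⟩ := ha'
    have hb₀A : b₀ ∈ A := by
      have : γ b₀ ∈ A := by rw [show γ b₀ = (a : P) from hb₀eq]; exact a.2
      have h2 : γ b₀ ∈ A.map γ.toMonoidHom := by rw [hA]; exact this
      obtain ⟨c, hc, hceq⟩ := h2
      rwa [← γ.injective hceq]
    refine ⟨⟨b₀, hb₀A⟩, hb₀, Subtype.ext ?_⟩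
    rw [MonoidHom.coe_coe, coe_restrictEquiv]
    exact hb₀eq

variable (A B)

/-- **The automorphism of `A/B` induced by `γ ∈ Aut(P)` preserving `A` and `B`** ([EtTh] Cor. 2.18 (i): an
isomorphism of topological groups "maps the subquotients to the subquotients").
[cite: MochizukiEtTh2009, Cor 2.18(i) p.60] -/
def autQuot [B.Normal] (γ : P ≃* P) (hA : A.map γ.toMonoidHom = A) (hB : B.map γ.toMonoidHom = B) :
    quot A B ≃* quot A B :=
  QuotientGroup.congr (B.subgroupOf A) (B.subgroupOf A) (restrictEquiv γ hA)
    (map_restrictEquiv_subgroupOf γ hA hB)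

/-- `autQuot γ [a] = [γ a]`. [cite: MochizukiEtTh2009, Cor 2.18(i) p.60] -/
@[simp] theorem autQuot_mk [B.Normal] (γ : P ≃* P) (hA : A.map γ.toMonoidHom = A)
    (hB : B.map γ.toMonoidHom = B) (a : ↥A) :
    autQuot A B γ hA hB (a : quot A B) = ((restrictEquiv γ hA a : ↥A) : quot A B) :=
  QuotientGroup.congr_mk _ _ _ _ a

/-- Functoriality: the identity induces the identity. [cite: MochizukiEtTh2009, Cor 2.18(i) p.60] -/
theorem autQuot_refl [B.Normal] (hA : A.map (MulEquiv.refl P).toMonoidHom = A)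
    (hB : B.map (MulEquiv.refl P).toMonoidHom = B) : autQuot A B (MulEquiv.refl P) hA hB = MulEquiv.refl _ := by
  refine MulEquiv.ext fun q => ?_
  induction q using QuotientGroup.induction_on with
  | H a =>
    rw [autQuot_mk, MulEquiv.refl_apply]
    congr 1

/-- Functoriality: composites induce composites. [cite: MochizukiEtTh2009, Cor 2.18(i) p.60] -/
theorem autQuot_trans [B.Normal] (γ δ : P ≃* P) (hA : A.map γ.toMonoidHom = A) (hB : B.map γ.toMonoidHom = B)
    (hA' : A.map δ.toMonoidHom = A) (hB' : B.map δ.toMonoidHom = B)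
    (hA'' : A.map (γ.trans δ).toMonoidHom = A) (hB'' : B.map (γ.trans δ).toMonoidHom = B) :
    autQuot A B (γ.trans δ) hA'' hB'' = (autQuot A B γ hA hB).trans (autQuot A B δ hA' hB') := by
  refine MulEquiv.ext fun q => ?_
  induction q using QuotientGroup.induction_on with
  | H a =>
    rw [MulEquiv.trans_apply, autQuot_mk, autQuot_mk, autQuot_mk]
    congr 1

/-- **Semilinearity**: `γ̄(x · q) = γ(x) · γ̄(q)` for the conjugation action `conjQuot` (`A`, `B` normal).
[cite: MochizukiEtTh2009, Cor 2.18(i) p.60] -/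
theorem autQuot_conjQuot [A.Normal] [B.Normal] (γ : P ≃* P) (hA : A.map γ.toMonoidHom = A)
    (hB : B.map γ.toMonoidHom = B) (x : P) (q : quot A B) :
    autQuot A B γ hA hB (conjQuot A B x q) = conjQuot A B (γ x) (autQuot A B γ hA hB q) := by
  induction q using QuotientGroup.induction_on with
  | H a =>
    rw [conjQuot_mk, autQuot_mk, autQuot_mk, conjQuot_mk]
    congr 1
    apply Subtype.ext
    change γ (x * (a : P) * x⁻¹) = γ x * γ (a : P) * (γ x)⁻¹
    rw [map_mul, map_mul, map_inv]

end SubquotientKit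

/-! ## The interior cyclotome of the model: `ρ_A(γ)` -/

namespace ModelCyclotomes

variable {N : ℕ+} {l : ℕ} (R : RigidData.{u} N l)

/-- **`ρ_A(γ)` at the [EtTh] model**: the automorphism of the interior cyclotome `(l·Δ_Θ)(M)` (part 5a's
`intCyc R`) induced by an automorphism `γ` of `Π^tp_X` preserving `Ker(Π^tp_X ↠ (Π^tp_X)^Θ)` and the inverse image
of `l·Δ_Θ` ([EtTh] Cor. 2.18 (i), clauses 4–5 of L2's `RigidData.Cor218_i`) — `autQuot` transported along
`intCycEquiv`. [cite: MochizukiEtTh2009, Cor 2.18(i) p.60] -/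
def intCycAut (γ : R.PiX ≃* R.PiX) (hK : R.thetaKer.map γ.toMonoidHom = R.thetaKer)
    (hL : R.lDeltaTheta.map γ.toMonoidHom = R.lDeltaTheta) : (intCyc R).carrier ≃* (intCyc R).carrier :=
  (intCycEquiv R).trans ((SubquotientKit.autQuot R.lDeltaTheta R.thetaKer γ hL hK).trans (intCycEquiv R).symm)

/-- `ρ_A(γ)` read through `intCycEquiv` is `autQuot γ`. [cite: MochizukiEtTh2009, Cor 2.18(i) p.60] -/
theorem intCycEquiv_intCycAut (γ : R.PiX ≃* R.PiX) (hK : R.thetaKer.map γ.toMonoidHom = R.thetaKer)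
    (hL : R.lDeltaTheta.map γ.toMonoidHom = R.lDeltaTheta) (c : (intCyc R).carrier) :
    intCycEquiv R (intCycAut R γ hK hL c) =
      SubquotientKit.autQuot R.lDeltaTheta R.thetaKer γ hL hK (intCycEquiv R c) := by
  unfold intCycAut
  rw [MulEquiv.trans_apply, MulEquiv.trans_apply, MulEquiv.apply_symm_apply]

/-- **Semilinearity of `ρ_A(γ)`** for the `Π_X(M)`-action on the interior cyclotome:
`ρ_A(γ)(x · c) = γ(x) · ρ_A(γ)(c)` — the field `rhoA_act` of `MonoThetaBaseDatum` at the model (PROVED).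
[claim: Mochizuki2012, status: disputed] (IUTchII §1 Cor 1.10, kurims p.47) -/
theorem intCycAut_intAct (γ : R.PiX ≃* R.PiX) (hK : R.thetaKer.map γ.toMonoidHom = R.thetaKer)
    (hL : R.lDeltaTheta.map γ.toMonoidHom = R.lDeltaTheta) (x : R.PiX) (c : (intCyc R).carrier) :
    intCycAut R γ hK hL (intAct R x c) = intAct R (γ x) (intCycAut R γ hK hL c) := by
  apply (intCycEquiv R).injective
  rw [intCycEquiv_intCycAut, intCycEquiv_intAct, intCycEquiv_intAct, intCycEquiv_intCycAut,
    SubquotientKit.autQuot_conjQuot]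

/-- Functoriality of `ρ_A`: the identity of `Π^tp_X` acts trivially (PROVED).
[claim: Mochizuki2012, status: disputed] (IUTchII §1 Cor 1.10, kurims p.47) -/
theorem intCycAut_refl (hK : R.thetaKer.map (MulEquiv.refl R.PiX).toMonoidHom = R.thetaKer)
    (hL : R.lDeltaTheta.map (MulEquiv.refl R.PiX).toMonoidHom = R.lDeltaTheta) :
    intCycAut R (MulEquiv.refl R.PiX) hK hL = MulEquiv.refl _ := by
  refine MulEquiv.ext fun c => (intCycEquiv R).injective ?_
  rw [intCycEquiv_intCycAut, SubquotientKit.autQuot_refl, MulEquiv.refl_apply, MulEquiv.refl_apply]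

/-- Functoriality of `ρ_A`: composites act by composites (PROVED).
[claim: Mochizuki2012, status: disputed] (IUTchII §1 Cor 1.10, kurims p.47) -/
theorem intCycAut_trans (γ δ : R.PiX ≃* R.PiX) (hK : R.thetaKer.map γ.toMonoidHom = R.thetaKer)
    (hL : R.lDeltaTheta.map γ.toMonoidHom = R.lDeltaTheta) (hK' : R.thetaKer.map δ.toMonoidHom = R.thetaKer)
    (hL' : R.lDeltaTheta.map δ.toMonoidHom = R.lDeltaTheta)
    (hK'' : R.thetaKer.map (γ.trans δ).toMonoidHom = R.thetaKer)
    (hL'' : R.lDeltaTheta.map (γ.trans δ).toMonoidHom = R.lDeltaTheta) :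
    intCycAut R (γ.trans δ) hK'' hL'' = (intCycAut R γ hK hL).trans (intCycAut R δ hK' hL') := by
  refine MulEquiv.ext fun c => (intCycEquiv R).injective ?_
  rw [intCycEquiv_intCycAut, MulEquiv.trans_apply, intCycEquiv_intCycAut, intCycEquiv_intCycAut,
    SubquotientKit.autQuot_trans R.lDeltaTheta R.thetaKer γ δ hL hK hL' hK' hL'' hK'', MulEquiv.trans_apply]

/-- **Compatibility with the mod-`N` rigidity identification**: through `intModEquiv R : (l·Δ_Θ)(M) ⊗ ℤ/N ⥲ μ_N`
(induced by L2's `thetaMod`), `ρ_A(γ)` acts by ANY coefficient automorphism `γ̄_μ` satisfying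
`thetaMod (γ g) = γ̄_μ (thetaMod g)` (such a `γ̄_μ` exists: L2 `RigidData.exists_mulEquiv_thetaMod_comp`) — the
interior half of `rho_comm` at the model (PROVED). [cite: MochizukiEtTh2009, Cor 2.19(i) p.64] -/
theorem intModEquiv_intCycAut (γ : R.PiX ≃* R.PiX) (hK : R.thetaKer.map γ.toMonoidHom = R.thetaKer)
    (hL : R.lDeltaTheta.map γ.toMonoidHom = R.lDeltaTheta) (γμ : R.mu ≃* R.mu)
    (hγμ : ∀ (g : R.lDeltaTheta) (hg : γ g ∈ R.lDeltaTheta), R.thetaMod ⟨γ g, hg⟩ = γμ (R.thetaMod g))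
    (c : (intCyc R).carrier) :
    intModEquiv R ((intCycAut R γ hK hL c : (intCyc R).carrier) : ModPow (intCyc R).carrier (N : ℕ)) =
      γμ (intModEquiv R (c : ModPow (intCyc R).carrier (N : ℕ))) := by
  unfold intModEquiv
  rw [MulEquiv.trans_apply, MulEquiv.trans_apply, modPowCongr_mk, modPowCongr_mk, intCycEquiv_intCycAut]
  generalize intCycEquiv R c = q
  induction q using QuotientGroup.induction_on with
  | H g =>
    rw [SubquotientKit.autQuot_mk, lDeltaModEquiv_mk_mk, lDeltaModEquiv_mk_mk]
    exact hγμ g _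

/-- **`ρ_A` from the named fact [EtTh] Cor. 2.18 (i)**: under L2's `RigidData.Cor218_i` every automorphism of
the topological group `Π^tp_X` acts on the interior cyclotome of the model (DEFINED by `intCycAut` at the
clauses of the fact). [cite: MochizukiEtTh2009, Cor 2.18(i) p.60] -/
def intCycAutOfCor218i (h218i : R.Cor218_i) (γ : R.PiX ≃ₜ* R.PiX) :
    (intCyc R).carrier ≃* (intCyc R).carrier :=
  intCycAut R γ.toMulEquiv (h218i γ).2.2.2.1 (h218i γ).2.2.2.2.1

/-- Semilinearity of `ρ_A` from Cor. 2.18 (i) (PROVED). [cite: MochizukiEtTh2009, Cor 2.18(i) p.60] -/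
theorem intCycAutOfCor218i_intAct (h218i : R.Cor218_i) (γ : R.PiX ≃ₜ* R.PiX) (x : R.PiX)
    (c : (intCyc R).carrier) :
    intCycAutOfCor218i R h218i γ (intAct R x c) = intAct R (γ x) (intCycAutOfCor218i R h218i γ c) :=
  intCycAut_intAct R γ.toMulEquiv _ _ x c

end ModelCyclotomes

end Literature.IUT.HodgeArakelov
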